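import Mathlib
import Summits.NavierStokesRegularity.NavierStokesRegularity.Theorems.SubOnsagerCeilingKPDarkShell
import HarnessLib

/-!
# KP networks proper: the LOW-ENERGY BALANCE and the ν-uniform FLUX and DISSIPATION BUDGETS (helper file
# for crux stmt-NavierStokesRegularity-27057 `SubOnsagerCeiling.ForwardTailCeilingKP`, `--supports`; companion
# of `SubOnsagerCeilingKPDarkShell`)

For a KP network proper `α ∈ E₂(R)` (symmetric, cancelling, ORTHANT, DIAGONAL feed forms) the shell energies
form a nearest-neighbour flux chain (`kpProper_shellEnergy_identity`, p640757) whose bond flux out of shell `n`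
is `OUT_n = (1+ε₀)^{5n/2} Σ_{i,j} w_{ij} X_{i,n}² X_{j,n+1} ≥ 0` (`w_{ij} = α i i j (0,0,1) ≥ 0`, receiving
amplitudes `≥ 0`).  `SubOnsagerCeilingKPDarkShell` used the differential form (low energies never increase).
This file records the INTEGRATED form along every honest non-negative `ν`-viscous solution from a one-shell
datum on shell `0`:

* `kpProper_lowEnergy_hasDerivWithinAt` — the closed-form derivative within `[0,s]`:
  `d/dt Σ_{m ≤ n} Σ_i ½X_{i,m}² = −OUT_n − Σ_{m ≤ n} 2ν(1+ε₀)^{2m} Σ_i ½X_{i,m}²` (the in-fluxes telescope,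
  the in-flux of shell `0` vanishes);
* `kpProper_lowEnergy_balance` — **the low-energy balance**: for every `n` and `t ∈ [0,s]`,
  `Σ_{m ≤ n} Σ_i ½X_{i,m}(t)² + ∫₀ᵗ OUT_n + ∫₀ᵗ Σ_{m ≤ n} 2ν(1+ε₀)^{2m} Σ_i ½X_{i,m}² = E₀`;
* `kpProper_bondFlux_budget` — **ν-UNIFORM FLUX BUDGET**: `∫₀ᵗ (1+ε₀)^{5n/2} Σ_{i,j} w_{ij} X_{i,n}² X_{j,n+1} ≤ E₀`
  for every bond `n → n+1` (the time-averaged Kolmogorov bound of the class: on average over `[0,t]`,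
  `(1+ε₀)^{5n/2} w X_{i,n}² X_{j,n+1} ≤ E₀/t`);
* `kpProper_dissipation_budget` — **ν-UNIFORM DISSIPATION BUDGET**: `∫₀ᵗ Σ_{m ≤ n} 2ν(1+ε₀)^{2m} Σ_i ½X_{i,m}² ≤ E₀`.

These are the integrated a-priori bounds any sup-in-time argument for the registered stubs
(`stub_primaryGradedLargeRatio` / `stub_primaryGradedSmallRatio`: a ν-uniform `θ > 1/2` barrier of the
primaries) starts from; they hold for the WHOLE class at every scale ratio.
HONEST FRAMING: statements about Tao-type MODEL lattice ODEs (route SubOnsagerCeiling, rung TL-M2Break);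
elementary energy bookkeeping, not a barrier; nothing here bears on Navier–Stokes regularity and no stub, crux
or summit is proved. [cite: Tao2016AveragedNS, §4 (4.2)–(4.3), (4.8)–(4.9), (4.13)]
-/

noncomputable section

-- the sub-problem namespace `NavierStokesRegularity.NavierStokesRegularity` is the tree's layout (D-0017)
set_option linter.dupNamespace false

namespace Summit.NavierStokesRegularity.NavierStokesRegularity.Theorems

open Set Finset MeasureTheory intervalIntegral
open scoped Topology
open Literature.Analysis.FluidPDE.TaoCascade

variable {α : Fin 4 → Fin 4 → Fin 4 → ℤ × ℤ × ℤ → ℝ}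

/-- **Closed-form derivative of the low energy of a KP network proper.**  Along a solution of the `ν`-viscous
lattice within `[0,s]` vanishing below shell `0`, for every `n : ℕ` and `t ∈ [0,s]`:
`d/dt Σ_{m ≤ n} Σ_i ½X_{i,m}² = −(1+ε₀)^{5n/2} Σ_{i,j} w_{ij} X_{i,n}² X_{j,n+1} − Σ_{m ≤ n} 2ν(1+ε₀)^{2m} Σ_i ½X_{i,m}²`
within `[0,s]`. MODEL lattice statement. [cite: Tao2016AveragedNS, §4 (4.8)–(4.9), (4.13)] -/
theorem kpProper_lowEnergy_hasDerivWithinAt (hs : IsSymmetricCoeff α) (hc : IsCancellingCoeff α)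
    (hO : ∀ (Y : Fin 4 → ℤ → ℝ → ℝ) (τ : ℝ), (∀ (j : Fin 4) (k : ℤ), 1 ≤ k → 0 ≤ Y j k τ) →
      ∀ δ : ℝ, 0 < δ → ∀ (i : Fin 4) (n : ℤ), 1 ≤ n → Y i n τ = 0 → 0 ≤ quadTerm δ α Y i n τ)
    (hD : ∀ a b i : Fin 4, a ≠ b → α a b i (0, 0, 1) = 0)
    {ε₀ ν s : ℝ} {X : Fin 4 → ℤ → ℝ → ℝ}
    (hvan : ∀ (i : Fin 4) (k : ℤ), k < 0 → ∀ t : ℝ, X i k t = 0)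
    (hode : ∀ (i : Fin 4) (k : ℤ), ∀ t ∈ Icc (0 : ℝ) s, HasDerivWithinAt (X i k)
      (quadTerm ε₀ α X i k t - ν * (1 + ε₀) ^ ((2 : ℝ) * k) * X i k t) (Icc (0 : ℝ) s) t)
    (n : ℕ) {t : ℝ} (ht : t ∈ Icc (0 : ℝ) s) :
    HasDerivWithinAt (fun τ => ∑ m ∈ Finset.range (n + 1), ∑ i, (1 / 2 : ℝ) * X i (m : ℤ) τ ^ 2)
      (-((1 + ε₀) ^ ((5 : ℝ) * (n : ℝ) / 2) * ∑ i, ∑ j, α i i j (0, 0, 1) * X i (n : ℤ) t ^ 2 * X j ((n : ℤ) + 1) t) -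
        ∑ m ∈ Finset.range (n + 1),
          2 * (ν * (1 + ε₀) ^ ((2 : ℝ) * (m : ℝ))) * ∑ i, (1 / 2 : ℝ) * X i (m : ℤ) t ^ 2) (Icc 0 s) t := by
  -- the in-flux of shell `m`
  set IN : ℕ → ℝ := fun m => (1 + ε₀) ^ ((5 : ℝ) * (((m : ℤ) : ℝ) - 1) / 2) *
    ∑ i, ∑ a, α a a i (0, 0, 1) * X a ((m : ℤ) - 1) t ^ 2 * X i (m : ℤ) t with hIN
  have hflux : ∀ m : ℕ, ∑ i, X i (m : ℤ) t * quadTerm ε₀ α X i (m : ℤ) t = IN m - IN (m + 1) := by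
    intro m
    rw [kpProper_shellEnergy_identity hs hc hO hD ε₀ X (m : ℤ) t, kpProper_outFlux_eq_inFlux_succ ε₀ X (m : ℤ) t]
    simp only [hIN]
    push_cast
    simp only [add_sub_cancel_right]
  have hsum := HasDerivWithinAt.fun_sum (u := Finset.range (n + 1))
    (A := fun m θ => ∑ i, (1 / 2 : ℝ) * X i (m : ℤ) θ ^ 2)
    (A' := fun m => ∑ i, X i (m : ℤ) t * quadTerm ε₀ α X i (m : ℤ) t -
      2 * (ν * (1 + ε₀) ^ ((2 : ℝ) * ((m : ℤ) : ℝ))) * ∑ i, (1 / 2 : ℝ) * X i (m : ℤ) t ^ 2)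
    (x := t) (s := Icc 0 s)
    (fun m _ => forwardSourceSmoothing_hasDerivWithinAt_denergy Finset.univ (m : ℤ) (fun i => hode i (m : ℤ)) ht)
  refine hsum.congr_deriv ?_
  have h1 : ∑ m ∈ Finset.range (n + 1), ∑ i, X i (m : ℤ) t * quadTerm ε₀ α X i (m : ℤ) t = IN 0 - IN (n + 1) := by
    rw [Finset.sum_congr rfl fun m _ => hflux m]
    exact Finset.sum_range_sub' IN (n + 1)
  have hIN0 : IN 0 = 0 := by
    have hz : ∀ a, X a (((0 : ℕ) : ℤ) - 1) t = 0 := fun a => hvan a _ (by norm_num) t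
    simp only [hIN, hz]
    simp
  have hINn : IN (n + 1) =
      (1 + ε₀) ^ ((5 : ℝ) * (n : ℝ) / 2) * ∑ i, ∑ j, α i i j (0, 0, 1) * X i (n : ℤ) t ^ 2 * X j ((n : ℤ) + 1) t := by
    simp only [hIN]
    push_cast
    simp only [add_sub_cancel_right]
    rw [Finset.sum_comm]
  rw [Finset.sum_sub_distrib, h1, hIN0, hINn]
  push_cast
  ring

/-- The bond flux `OUT_n(τ) = (1+ε₀)^{5n/2} Σ_{i,j} w_{ij} X_{i,n}(τ)² X_{j,n+1}(τ)` is continuous in `τ`.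
[folklore] -/
theorem kpProper_outFlux_continuous {ε₀ : ℝ} {X : Fin 4 → ℤ → ℝ → ℝ} (hXc : ∀ (i : Fin 4) (k : ℤ), Continuous (X i k))
    (n : ℕ) : Continuous (fun τ => (1 + ε₀) ^ ((5 : ℝ) * (n : ℝ) / 2) *
      ∑ i, ∑ j, α i i j (0, 0, 1) * X i (n : ℤ) τ ^ 2 * X j ((n : ℤ) + 1) τ) := by
  refine continuous_const.mul (continuous_finsetSum _ fun i _ => continuous_finsetSum _ fun j _ => ?_)
  exact (continuous_const.mul ((hXc i _).pow 2)).mul (hXc j _)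

/-- The low dissipation rate `Σ_{m ≤ n} 2ν(1+ε₀)^{2m} Σ_i ½X_{i,m}(τ)²` is continuous in `τ`. [folklore] -/
theorem kpProper_lowDissipation_continuous {ε₀ ν : ℝ} {X : Fin 4 → ℤ → ℝ → ℝ}
    (hXc : ∀ (i : Fin 4) (k : ℤ), Continuous (X i k)) (n : ℕ) :
    Continuous (fun τ => ∑ m ∈ Finset.range (n + 1),
      2 * (ν * (1 + ε₀) ^ ((2 : ℝ) * (m : ℝ))) * ∑ i, (1 / 2 : ℝ) * X i (m : ℤ) τ ^ 2) :=
  continuous_finsetSum _ fun m _ =>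
    continuous_const.mul (forwardSourceSmoothing_continuous_denergy Finset.univ (m : ℤ) (fun i => hXc i _))

/-- **THE LOW-ENERGY BALANCE OF A KP NETWORK PROPER.**  Along an honest `ν`-viscous solution from a one-shell
datum `X₀` on shell `0` (no negative shells, continuous modes, the exact viscous equation within `[0,s]`), for
every `n : ℕ` and `t ∈ [0,s]`:
`Σ_{m ≤ n} Σ_i ½X_{i,m}(t)² + ∫₀ᵗ (1+ε₀)^{5n/2} Σ_{i,j} w_{ij} X_{i,n}² X_{j,n+1} + ∫₀ᵗ Σ_{m ≤ n} 2ν(1+ε₀)^{2m} Σ_i ½X_{i,m}² = Σ_i ½(X₀)_i²`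
— low energy + flux through the bond `n → n+1` + low dissipation = initial energy. MODEL lattice statement.
[cite: Tao2016AveragedNS, §4 (4.8)–(4.9), (4.13)] -/
theorem kpProper_lowEnergy_balance (hs : IsSymmetricCoeff α) (hc : IsCancellingCoeff α)
    (hO : ∀ (Y : Fin 4 → ℤ → ℝ → ℝ) (τ : ℝ), (∀ (j : Fin 4) (k : ℤ), 1 ≤ k → 0 ≤ Y j k τ) →
      ∀ δ : ℝ, 0 < δ → ∀ (i : Fin 4) (n : ℤ), 1 ≤ n → Y i n τ = 0 → 0 ≤ quadTerm δ α Y i n τ)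
    (hD : ∀ a b i : Fin 4, a ≠ b → α a b i (0, 0, 1) = 0)
    {ε₀ ν s : ℝ} {X₀ : Fin 4 → ℝ} {X : Fin 4 → ℤ → ℝ → ℝ}
    (hdat : ∀ (i : Fin 4) (k : ℤ), X i k 0 = if k = 0 then X₀ i else 0)
    (hvan : ∀ (i : Fin 4) (k : ℤ), k < 0 → ∀ t : ℝ, X i k t = 0)
    (hXc : ∀ (i : Fin 4) (k : ℤ), Continuous (X i k))
    (hode : ∀ (i : Fin 4) (k : ℤ), ∀ t ∈ Icc (0 : ℝ) s, HasDerivWithinAt (X i k)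
      (quadTerm ε₀ α X i k t - ν * (1 + ε₀) ^ ((2 : ℝ) * k) * X i k t) (Icc (0 : ℝ) s) t) (n : ℕ) :
    ∀ t ∈ Icc (0 : ℝ) s,
      ∑ m ∈ Finset.range (n + 1), ∑ i, (1 / 2 : ℝ) * X i (m : ℤ) t ^ 2 +
        (∫ τ in (0 : ℝ)..t, (1 + ε₀) ^ ((5 : ℝ) * (n : ℝ) / 2) *
          ∑ i, ∑ j, α i i j (0, 0, 1) * X i (n : ℤ) τ ^ 2 * X j ((n : ℤ) + 1) τ) +
        (∫ τ in (0 : ℝ)..t, ∑ m ∈ Finset.range (n + 1),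
          2 * (ν * (1 + ε₀) ^ ((2 : ℝ) * (m : ℝ))) * ∑ i, (1 / 2 : ℝ) * X i (m : ℤ) τ ^ 2) =
        ∑ i, (1 / 2 : ℝ) * X₀ i ^ 2 := by
  set E : ℝ → ℝ := fun τ => ∑ m ∈ Finset.range (n + 1), ∑ i, (1 / 2 : ℝ) * X i (m : ℤ) τ ^ 2 with hE
  set OUT : ℝ → ℝ := fun τ => (1 + ε₀) ^ ((5 : ℝ) * (n : ℝ) / 2) *
    ∑ i, ∑ j, α i i j (0, 0, 1) * X i (n : ℤ) τ ^ 2 * X j ((n : ℤ) + 1) τ with hOUT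
  set DISS : ℝ → ℝ := fun τ => ∑ m ∈ Finset.range (n + 1),
    2 * (ν * (1 + ε₀) ^ ((2 : ℝ) * (m : ℝ))) * ∑ i, (1 / 2 : ℝ) * X i (m : ℤ) τ ^ 2 with hDISS
  have hOUTc : Continuous OUT := kpProper_outFlux_continuous hXc n
  have hDISSc : Continuous DISS := kpProper_lowDissipation_continuous hXc n
  have hEc : Continuous E := continuous_finsetSum _ fun m _ =>
    forwardSourceSmoothing_continuous_denergy Finset.univ (m : ℤ) (fun i => hXc i _)
  -- the balance function and its (vanishing) derivative
  set G : ℝ → ℝ := fun τ => E τ + (∫ x in (0 : ℝ)..τ, OUT x) + ∫ x in (0 : ℝ)..τ, DISS x with hG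
  have hGc : ContinuousOn G (Icc 0 s) := by
    refine Continuous.continuousOn ?_
    exact (hEc.add (intervalIntegral.continuous_primitive (fun a b => hOUTc.intervalIntegrable a b) 0)).add
      (intervalIntegral.continuous_primitive (fun a b => hDISSc.intervalIntegrable a b) 0)
  have hGd : ∀ τ ∈ Icc (0 : ℝ) s, HasDerivWithinAt G 0 (Icc 0 s) τ := by
    intro τ hτ
    have h1 : HasDerivWithinAt E (-OUT τ - DISS τ) (Icc 0 s) τ :=
      kpProper_lowEnergy_hasDerivWithinAt hs hc hO hD hvan hode n hτ
    have h2 : HasDerivWithinAt (fun u => ∫ x in (0 : ℝ)..u, OUT x) (OUT τ) (Icc 0 s) τ :=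
      (intervalIntegral.integral_hasDerivAt_right (hOUTc.intervalIntegrable _ _)
        (hOUTc.stronglyMeasurableAtFilter _ _) hOUTc.continuousAt).hasDerivWithinAt
    have h3 : HasDerivWithinAt (fun u => ∫ x in (0 : ℝ)..u, DISS x) (DISS τ) (Icc 0 s) τ :=
      (intervalIntegral.integral_hasDerivAt_right (hDISSc.intervalIntegrable _ _)
        (hDISSc.stronglyMeasurableAtFilter _ _) hDISSc.continuousAt).hasDerivWithinAt
    have h := (h1.add h2).add h3
    refine h.congr_deriv ?_
    ring
  -- a function with vanishing right derivative on `[0,s]` is constant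
  have hGd' : ∀ u ∈ Ico (0 : ℝ) s, HasDerivWithinAt G 0 (Ici u) u := fun u hu =>
    (hGd u (Ico_subset_Icc_self hu)).mono_of_mem_nhdsWithin
      (Filter.mem_of_superset (Icc_mem_nhdsGE hu.2) (Icc_subset_Icc hu.1 le_rfl))
  have hG0 : G 0 = ∑ i, (1 / 2 : ℝ) * X₀ i ^ 2 := by
    have hne : ∀ m : ℕ, (m : ℤ) + 1 ≠ 0 := fun m => by omega
    simp only [hG, hE, intervalIntegral.integral_same, add_zero]
    rw [Finset.sum_range_succ']
    simp [hdat, hne]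
  intro t ht
  have h := constant_of_has_deriv_right_zero hGc hGd' t ht
  rw [hG0] at h
  exact h

/-- **ν-UNIFORM FLUX BUDGET.**  Along an honest non-negative `ν`-viscous solution (`ν ≥ 0`) of a KP network
proper from a one-shell datum, the total energy carried through the bond `n → n+1` up to time `t ∈ [0,s]` is
at most the initial energy: `∫₀ᵗ (1+ε₀)^{5n/2} Σ_{i,j} w_{ij} X_{i,n}² X_{j,n+1} ≤ Σ_i ½(X₀)_i²` — uniformly in
`ν`, `n`, `t` (the time-averaged Kolmogorov bound of the class). MODEL lattice statement.
[cite: Tao2016AveragedNS, §4 (4.8)–(4.9), (4.13)] -/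
theorem kpProper_bondFlux_budget (hs : IsSymmetricCoeff α) (hc : IsCancellingCoeff α)
    (hO : ∀ (Y : Fin 4 → ℤ → ℝ → ℝ) (τ : ℝ), (∀ (j : Fin 4) (k : ℤ), 1 ≤ k → 0 ≤ Y j k τ) →
      ∀ δ : ℝ, 0 < δ → ∀ (i : Fin 4) (n : ℤ), 1 ≤ n → Y i n τ = 0 → 0 ≤ quadTerm δ α Y i n τ)
    (hD : ∀ a b i : Fin 4, a ≠ b → α a b i (0, 0, 1) = 0)
    {ε₀ ν s : ℝ} (hε : 0 < 1 + ε₀) (hν : 0 ≤ ν) {X₀ : Fin 4 → ℝ} {X : Fin 4 → ℤ → ℝ → ℝ}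
    (hdat : ∀ (i : Fin 4) (k : ℤ), X i k 0 = if k = 0 then X₀ i else 0)
    (hvan : ∀ (i : Fin 4) (k : ℤ), k < 0 → ∀ t : ℝ, X i k t = 0)
    (hXc : ∀ (i : Fin 4) (k : ℤ), Continuous (X i k))
    (hode : ∀ (i : Fin 4) (k : ℤ), ∀ t ∈ Icc (0 : ℝ) s, HasDerivWithinAt (X i k)
      (quadTerm ε₀ α X i k t - ν * (1 + ε₀) ^ ((2 : ℝ) * k) * X i k t) (Icc (0 : ℝ) s) t) (n : ℕ) :
    ∀ t ∈ Icc (0 : ℝ) s,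
      ∫ τ in (0 : ℝ)..t, (1 + ε₀) ^ ((5 : ℝ) * (n : ℝ) / 2) *
          ∑ i, ∑ j, α i i j (0, 0, 1) * X i (n : ℤ) τ ^ 2 * X j ((n : ℤ) + 1) τ ≤
        ∑ i, (1 / 2 : ℝ) * X₀ i ^ 2 := by
  intro t ht
  have hbal := kpProper_lowEnergy_balance hs hc hO hD hdat hvan hXc hode n t ht
  have hE : 0 ≤ ∑ m ∈ Finset.range (n + 1), ∑ i, (1 / 2 : ℝ) * X i (m : ℤ) t ^ 2 :=
    Finset.sum_nonneg fun m _ => Finset.sum_nonneg fun i _ => by positivity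
  have hD' : 0 ≤ ∫ τ in (0 : ℝ)..t, ∑ m ∈ Finset.range (n + 1),
      2 * (ν * (1 + ε₀) ^ ((2 : ℝ) * (m : ℝ))) * ∑ i, (1 / 2 : ℝ) * X i (m : ℤ) τ ^ 2 := by
    refine intervalIntegral.integral_nonneg ht.1 fun τ _ => Finset.sum_nonneg fun m _ => ?_
    exact mul_nonneg (mul_nonneg (by norm_num) (mul_nonneg hν (Real.rpow_pos_of_pos hε _).le))
      (Finset.sum_nonneg fun i _ => by positivity)
  linarith

/-- **ν-UNIFORM DISSIPATION BUDGET.**  Along an honest non-negative `ν`-viscous solution (`ν ≥ 0`) of a KP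
network proper from a one-shell datum, the energy dissipated below shell `n` up to time `t ∈ [0,s]` is at most
the initial energy: `∫₀ᵗ Σ_{m ≤ n} 2ν(1+ε₀)^{2m} Σ_i ½X_{i,m}² ≤ Σ_i ½(X₀)_i²` — uniformly in `ν`, `n`, `t`.
MODEL lattice statement. [cite: Tao2016AveragedNS, §4 (4.8)–(4.9), (4.13)] -/
theorem kpProper_dissipation_budget (hs : IsSymmetricCoeff α) (hc : IsCancellingCoeff α)
    (hO : ∀ (Y : Fin 4 → ℤ → ℝ → ℝ) (τ : ℝ), (∀ (j : Fin 4) (k : ℤ), 1 ≤ k → 0 ≤ Y j k τ) →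
      ∀ δ : ℝ, 0 < δ → ∀ (i : Fin 4) (n : ℤ), 1 ≤ n → Y i n τ = 0 → 0 ≤ quadTerm δ α Y i n τ)
    (hD : ∀ a b i : Fin 4, a ≠ b → α a b i (0, 0, 1) = 0)
    {ε₀ ν s : ℝ} (hε : 0 < 1 + ε₀) {X₀ : Fin 4 → ℝ} {X : Fin 4 → ℤ → ℝ → ℝ}
    (hdat : ∀ (i : Fin 4) (k : ℤ), X i k 0 = if k = 0 then X₀ i else 0)
    (hvan : ∀ (i : Fin 4) (k : ℤ), k < 0 → ∀ t : ℝ, X i k t = 0)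
    (hXc : ∀ (i : Fin 4) (k : ℤ), Continuous (X i k))
    (hode : ∀ (i : Fin 4) (k : ℤ), ∀ t ∈ Icc (0 : ℝ) s, HasDerivWithinAt (X i k)
      (quadTerm ε₀ α X i k t - ν * (1 + ε₀) ^ ((2 : ℝ) * k) * X i k t) (Icc (0 : ℝ) s) t)
    (hnn : ∀ t ∈ Icc (0 : ℝ) s, ∀ (i : Fin 4) (k : ℤ), 1 ≤ k → 0 ≤ X i k t) (n : ℕ) :
    ∀ t ∈ Icc (0 : ℝ) s,
      ∫ τ in (0 : ℝ)..t, ∑ m ∈ Finset.range (n + 1),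
          2 * (ν * (1 + ε₀) ^ ((2 : ℝ) * (m : ℝ))) * ∑ i, (1 / 2 : ℝ) * X i (m : ℤ) τ ^ 2 ≤
        ∑ i, (1 / 2 : ℝ) * X₀ i ^ 2 := by
  intro t ht
  have hbal := kpProper_lowEnergy_balance hs hc hO hD hdat hvan hXc hode n t ht
  have hE : 0 ≤ ∑ m ∈ Finset.range (n + 1), ∑ i, (1 / 2 : ℝ) * X i (m : ℤ) t ^ 2 :=
    Finset.sum_nonneg fun m _ => Finset.sum_nonneg fun i _ => by positivity
  have hF : 0 ≤ ∫ τ in (0 : ℝ)..t, (1 + ε₀) ^ ((5 : ℝ) * (n : ℝ) / 2) *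
      ∑ i, ∑ j, α i i j (0, 0, 1) * X i (n : ℤ) τ ^ 2 * X j ((n : ℤ) + 1) τ := by
    refine intervalIntegral.integral_nonneg ht.1 fun τ hτ => ?_
    have hτs : τ ∈ Icc (0 : ℝ) s := ⟨hτ.1, hτ.2.trans ht.2⟩
    refine mul_nonneg (Real.rpow_pos_of_pos hε _).le
      (Finset.sum_nonneg fun i _ => Finset.sum_nonneg fun j _ => ?_)
    refine mul_nonneg (mul_nonneg (kpProper_feed_nonneg hO i j) (sq_nonneg _)) ?_
    exact hnn τ hτs j _ (by omega)
  linarith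

/-! ## A band of shells holds at most what entered through its lower gate (appended 2026-08-31) -/

/-- **GATE-FLUX BOUND FOR A BAND OF SHELLS.**  Along an honest non-negative `ν`-viscous solution (`ν ≥ 0`) of a
KP network proper from a one-shell datum on shell `0`, for every band of shells `[m+1, N]` (`m ≤ N`) and `t ∈ [0,s]`:
`Σ_{k=m+1}^{N} Σ_i ½X_{i,k}(t)² ≤ ∫₀ᵗ (1+ε₀)^{5m/2} Σ_{i,j} w_{ij} X_{i,m}² X_{j,m+1}` — the energy of a band never
exceeds the energy that has passed its lower gate (difference of two low-energy balances; out-flux at the top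
and dissipation are `≥ 0`).  With `S ⊆ univ` this bounds the crux's observable `Σ_{k=n..N} Σ_{i∈S} ½X_{i,k}(t)²`
by the time-integrated flux through the bond `n−1 → n`. MODEL lattice statement; no stub, crux or summit is
proved. [cite: Tao2016AveragedNS, §4 (4.8)–(4.9), (4.13)] -/
theorem kpProper_bandEnergy_le_gateFlux (hs : IsSymmetricCoeff α) (hc : IsCancellingCoeff α)
    (hO : ∀ (Y : Fin 4 → ℤ → ℝ → ℝ) (τ : ℝ), (∀ (j : Fin 4) (k : ℤ), 1 ≤ k → 0 ≤ Y j k τ) →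
      ∀ δ : ℝ, 0 < δ → ∀ (i : Fin 4) (n : ℤ), 1 ≤ n → Y i n τ = 0 → 0 ≤ quadTerm δ α Y i n τ)
    (hD : ∀ a b i : Fin 4, a ≠ b → α a b i (0, 0, 1) = 0)
    {ε₀ ν s : ℝ} (hε : 0 < 1 + ε₀) (hν : 0 ≤ ν) {X₀ : Fin 4 → ℝ} {X : Fin 4 → ℤ → ℝ → ℝ}
    (hdat : ∀ (i : Fin 4) (k : ℤ), X i k 0 = if k = 0 then X₀ i else 0)
    (hvan : ∀ (i : Fin 4) (k : ℤ), k < 0 → ∀ t : ℝ, X i k t = 0)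
    (hXc : ∀ (i : Fin 4) (k : ℤ), Continuous (X i k))
    (hode : ∀ (i : Fin 4) (k : ℤ), ∀ t ∈ Icc (0 : ℝ) s, HasDerivWithinAt (X i k)
      (quadTerm ε₀ α X i k t - ν * (1 + ε₀) ^ ((2 : ℝ) * k) * X i k t) (Icc (0 : ℝ) s) t)
    (hnn : ∀ t ∈ Icc (0 : ℝ) s, ∀ (i : Fin 4) (k : ℤ), 1 ≤ k → 0 ≤ X i k t) {m N : ℕ} (hmN : m ≤ N) :
    ∀ t ∈ Icc (0 : ℝ) s,
      ∑ k ∈ Finset.Icc (m + 1) N, ∑ i, (1 / 2 : ℝ) * X i (k : ℤ) t ^ 2 ≤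
        ∫ τ in (0 : ℝ)..t, (1 + ε₀) ^ ((5 : ℝ) * (m : ℝ) / 2) *
          ∑ i, ∑ j, α i i j (0, 0, 1) * X i (m : ℤ) τ ^ 2 * X j ((m : ℤ) + 1) τ := by
  intro t ht
  have hN := kpProper_lowEnergy_balance hs hc hO hD hdat hvan hXc hode N t ht
  have hm := kpProper_lowEnergy_balance hs hc hO hD hdat hvan hXc hode m t ht
  -- the band as a difference of two low energies
  have hband : ∑ k ∈ Finset.Icc (m + 1) N, ∑ i, (1 / 2 : ℝ) * X i (k : ℤ) t ^ 2 =
      ∑ k ∈ Finset.range (N + 1), ∑ i, (1 / 2 : ℝ) * X i (k : ℤ) t ^ 2 -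
        ∑ k ∈ Finset.range (m + 1), ∑ i, (1 / 2 : ℝ) * X i (k : ℤ) t ^ 2 := by
    rw [← Finset.sum_Ico_eq_sub _ (by omega : m + 1 ≤ N + 1)]
    rfl
  -- the out-flux at the top is `≥ 0`
  have hF : 0 ≤ ∫ τ in (0 : ℝ)..t, (1 + ε₀) ^ ((5 : ℝ) * (N : ℝ) / 2) *
      ∑ i, ∑ j, α i i j (0, 0, 1) * X i (N : ℤ) τ ^ 2 * X j ((N : ℤ) + 1) τ := by
    refine intervalIntegral.integral_nonneg ht.1 fun τ hτ => ?_
    have hτs : τ ∈ Icc (0 : ℝ) s := ⟨hτ.1, hτ.2.trans ht.2⟩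
    refine mul_nonneg (Real.rpow_pos_of_pos hε _).le
      (Finset.sum_nonneg fun i _ => Finset.sum_nonneg fun j _ => ?_)
    refine mul_nonneg (mul_nonneg (kpProper_feed_nonneg hO i j) (sq_nonneg _)) ?_
    exact hnn τ hτs j _ (by omega)
  -- the band's dissipation is `≥ 0`: the low dissipation is monotone in the number of shells
  have hDmono : ∫ τ in (0 : ℝ)..t, ∑ k ∈ Finset.range (m + 1),
        2 * (ν * (1 + ε₀) ^ ((2 : ℝ) * (k : ℝ))) * ∑ i, (1 / 2 : ℝ) * X i (k : ℤ) τ ^ 2 ≤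
      ∫ τ in (0 : ℝ)..t, ∑ k ∈ Finset.range (N + 1),
        2 * (ν * (1 + ε₀) ^ ((2 : ℝ) * (k : ℝ))) * ∑ i, (1 / 2 : ℝ) * X i (k : ℤ) τ ^ 2 := by
    refine intervalIntegral.integral_mono_on ht.1
      ((kpProper_lowDissipation_continuous hXc m).intervalIntegrable _ _)
      ((kpProper_lowDissipation_continuous hXc N).intervalIntegrable _ _) fun τ _ => ?_
    refine Finset.sum_le_sum_of_subset_of_nonneg (Finset.range_subset_range.2 (by omega))
      fun k _ _ => ?_
    exact mul_nonneg (mul_nonneg (by norm_num) (mul_nonneg hν (Real.rpow_pos_of_pos hε _).le))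
      (Finset.sum_nonneg fun i _ => by positivity)
  rw [hband]
  linarith

/-! ## Low energies are non-increasing IN TIME (appended 2026-08-31) -/

/-- **NO BACKSCATTER: the energy below any shell is NON-INCREASING IN TIME.**  Along an honest non-negative
`ν`-viscous solution (`ν ≥ 0`) of a KP network proper within `[0,s]` (no negative shells), for every `n : ℕ` the
low energy `t ↦ Σ_{m ≤ n} Σ_i ½X_{i,m}(t)²` is antitone on `[0,s]` (its derivative is `−OUT_n − dissipation ≤ 0`:
energy only moves up the shells) — the time-local form of `kpProper_lowEnergy_le` (which compares with `t = 0`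
only), usable for arguments restarted at intermediate times. MODEL lattice statement (the positive-solution
monotonicity of the energy flow of dyadic models, for the whole KP class); no stub, crux or summit is proved.
[cite: Tao2016AveragedNS, §4 (4.8)–(4.9), (4.13)] -/
theorem kpProper_lowEnergy_antitoneOn (hs : IsSymmetricCoeff α) (hc : IsCancellingCoeff α)
    (hO : ∀ (Y : Fin 4 → ℤ → ℝ → ℝ) (τ : ℝ), (∀ (j : Fin 4) (k : ℤ), 1 ≤ k → 0 ≤ Y j k τ) →
      ∀ δ : ℝ, 0 < δ → ∀ (i : Fin 4) (n : ℤ), 1 ≤ n → Y i n τ = 0 → 0 ≤ quadTerm δ α Y i n τ)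
    (hD : ∀ a b i : Fin 4, a ≠ b → α a b i (0, 0, 1) = 0)
    {ε₀ ν s : ℝ} (hε : 0 < 1 + ε₀) (hν : 0 ≤ ν) {X : Fin 4 → ℤ → ℝ → ℝ}
    (hvan : ∀ (i : Fin 4) (k : ℤ), k < 0 → ∀ t : ℝ, X i k t = 0)
    (hXc : ∀ (i : Fin 4) (k : ℤ), Continuous (X i k))
    (hode : ∀ (i : Fin 4) (k : ℤ), ∀ t ∈ Icc (0 : ℝ) s, HasDerivWithinAt (X i k)
      (quadTerm ε₀ α X i k t - ν * (1 + ε₀) ^ ((2 : ℝ) * k) * X i k t) (Icc (0 : ℝ) s) t)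
    (hnn : ∀ t ∈ Icc (0 : ℝ) s, ∀ (i : Fin 4) (k : ℤ), 1 ≤ k → 0 ≤ X i k t) (n : ℕ) :
    AntitoneOn (fun t => ∑ m ∈ Finset.range (n + 1), ∑ i, (1 / 2 : ℝ) * X i (m : ℤ) t ^ 2) (Icc 0 s) := by
  have hEc : Continuous (fun t => ∑ m ∈ Finset.range (n + 1), ∑ i, (1 / 2 : ℝ) * X i (m : ℤ) t ^ 2) :=
    continuous_finsetSum _ fun m _ => forwardSourceSmoothing_continuous_denergy Finset.univ (m : ℤ) (fun i => hXc i _)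
  refine antitoneOn_of_hasDerivWithinAt_nonpos (convex_Icc 0 s) hEc.continuousOn
    (f' := fun t => -((1 + ε₀) ^ ((5 : ℝ) * (n : ℝ) / 2) *
        ∑ i, ∑ j, α i i j (0, 0, 1) * X i (n : ℤ) t ^ 2 * X j ((n : ℤ) + 1) t) -
      ∑ m ∈ Finset.range (n + 1), 2 * (ν * (1 + ε₀) ^ ((2 : ℝ) * (m : ℝ))) * ∑ i, (1 / 2 : ℝ) * X i (m : ℤ) t ^ 2)
    ?_ ?_
  · intro t ht
    rw [interior_Icc] at ht ⊢
    exact (kpProper_lowEnergy_hasDerivWithinAt hs hc hO hD hvan hode n (Ioo_subset_Icc_self ht)).mono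
      Ioo_subset_Icc_self
  · intro t ht
    rw [interior_Icc] at ht
    have hts : t ∈ Icc (0 : ℝ) s := Ioo_subset_Icc_self ht
    have hOUT : 0 ≤ (1 + ε₀) ^ ((5 : ℝ) * (n : ℝ) / 2) *
        ∑ i, ∑ j, α i i j (0, 0, 1) * X i (n : ℤ) t ^ 2 * X j ((n : ℤ) + 1) t := by
      refine mul_nonneg (Real.rpow_pos_of_pos hε _).le
        (Finset.sum_nonneg fun i _ => Finset.sum_nonneg fun j _ => ?_)
      refine mul_nonneg (mul_nonneg (kpProper_feed_nonneg hO i j) (sq_nonneg _)) ?_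
      exact hnn t hts j _ (by omega)
    have hDISS : 0 ≤ ∑ m ∈ Finset.range (n + 1),
        2 * (ν * (1 + ε₀) ^ ((2 : ℝ) * (m : ℝ))) * ∑ i, (1 / 2 : ℝ) * X i (m : ℤ) t ^ 2 :=
      Finset.sum_nonneg fun m _ => mul_nonneg
        (mul_nonneg (by norm_num) (mul_nonneg hν (Real.rpow_pos_of_pos hε _).le))
        (Finset.sum_nonneg fun i _ => by positivity)
    linarith

end Summit.NavierStokesRegularity.NavierStokesRegularity.Theorems

end
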